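import Literature.NumberTheory.PAdicHodge.KummerCocycleMatchingORational
import HarnessLib

/-!
# K1 for `ℚ_p`-rational points in the Kummer theory of `E` (`ℤ`-models, good supersingular `p ≥ 5`): fixed lifts, index step

Topic `Literature/NumberTheory/PAdicHodge`; namespaces `Literature.NumberTheory.EllipticCurves.TateModule` (§1) and
`Literature.NumberTheory.PAdicHodge.AinfTop` (§§2–4). THEOREMS ONLY (no definition, no named fact, no instance, no `sorry`).
The `W/ℤ`-currency twin of `KummerCocycleMatchingORational` (which does the same for the good `𝒪_D`-models of the K★ cells),
sequel of `KummerCocycleMatching` ★★ `isFilZeroCoboundary_kummer_curveF_of_five_le` (K1 for the algebraic Kummer cocycle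
`σ ↦ 1 ⊗ (σQₙ − Qₙ)ₙ` of a `p`-power division sequence `Q` of a `Γ_F`-fixed formal point whose parameter has a `Γ_F`-fixed lift to
`Ŵ(𝔫)`), removing the bookkeeping hypotheses:

* §1 `TateModule.mk_nsmul` — `(m • aₙ)ₙ = m • (aₙ)ₙ` in `T_p A` (any proofs of the side conditions).
* §2 `smul_eq_of_zCoord_eq_algebraMap_curveF` — a point of `E₁(ℂ_F)` (in `E(F̄)`, `E = W ⊗ F`) with parameter in `F` is `Γ_F`-fixed;
  `kummer_nsmul`, `one_tmul_toRational_nsmul_curveF` — the Kummer element / cocycle of `m • Q` is `m •` that of `Q`.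
* §3 ★ `isFilZeroCoboundary_kummer_curveF_of_five_le_of_zp` — ★★ for a base point `Q₀ ∈ E₁` with parameter `p·c`, `c ∈ ℤ_p`
  (every point of `Ê(pℤ_p)`; the fixed lift is the constant point `AinfTop.zpPt c`): no `u₀ / Q̂` hypothesis left.
* §4 ★★ `isFilZeroCoboundary_kummer_curveF_of_five_le_of_nsmul_of_zp` — THE INDEX STEP: for a `Γ_F`-fixed `Q₀ ∈ E(F̄)` and `m ≠ 0`
  with `m • Q₀ ∈ Ê(pℤ_p)`, the cocycle of EVERY `p`-power division sequence of `Q₀` is a `Fil⁰`-coboundary of `B_dR(F) ⊗ V_pE`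
  (`IsFilZeroCoboundary.of_nsmul`). With `F = ℚ_p` and `m = [E(ℚ_p) : Ê(pℤ_p)]` (finite: AEC VII.2.1, VII.6.3; tree
  `exists_nsmul_mem_level_of_Δ_ne_zero`) this is K1 for EVERY `ℚ_p`-rational point of a curve `W/ℤ` with good supersingular
  reduction at `p ≥ 5` — Bloch–Kato Example 3.11, the inclusion `κ(E(ℚ_p)) ⊗ ℚ ⊆ ker(H¹(ℚ_p, V_pE) → H¹(ℚ_p, B_dR⁺ ⊗ V_pE))`, at the
  cocycle level, unconditionally.

Crux K★ `stmt-BirchSwinnertonDyer-22226`, hT₂/K3 programme brick K1 ((S5a) `⟸` half on `ℤ`-models). BSD / K★ are not proved by this.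

## References
* [BlochKato1990] S. Bloch, K. Kato (1990), Ex. 3.10.1, Example 3.11.
* [SilvermanAEC2009] J. H. Silverman, *AEC* (2009), Prop. VII.2.1–VII.2.2, VII.6.3, VIII.§2.
* [Kato1993LNM1553] K. Kato, LNM 1553 (1993), Ch. II §1.2.4, Lemma 1.4.3.
-/

noncomputable section

open scoped TensorProduct Classical

/-! ## §1 Multiples in the Tate module -/

namespace Literature.NumberTheory.EllipticCurves.TateModule

universe u

/-- `(m • aₙ)ₙ = m • (aₙ)ₙ` in `T_p A`. [cite: SilvermanAEC2009, III.§7] -/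
theorem mk_nsmul {A : Type u} [AddCommGroup A] {p : ℕ} (m : ℕ) (a : ℕ → A) (h : ∀ n, p ^ n • a n = 0)
    (h' : ∀ n, p • a (n + 1) = a n) (hm : ∀ n, p ^ n • (m • a n) = 0) (hm' : ∀ n, p • (m • a (n + 1)) = m • a n) :
    TateModule.mk (fun n => m • a n) hm hm' = m • TateModule.mk a h h' :=
  TateModule.ext fun n => by rw [map_nsmul, proj_mk, proj_mk]

end Literature.NumberTheory.EllipticCurves.TateModule

namespace Literature.NumberTheory.PAdicHodge

open Literature Literature.NumberTheory.GaloisRepresentations Literature.NumberTheory.EllipticCurves WeierstrassCurve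
open Literature.NumberTheory.GaloisRepresentations.IsNonarchimedeanLocalField Field ValuativeRel
open Literature.NumberTheory.GaloisRepresentations.LubinTate Literature.NumberTheory.EllipticCurves.FormalGroupChart

namespace AinfTop

/-! ## §2 Rational parameters; multiples of division sequences (`ℤ`-models) -/

section Rational

variable {F : Type} [Field F] [ValuativeRel F] [TopologicalSpace F] [IsNonarchimedeanLocalField F]
  (W : WeierstrassCurve ℤ) {p : ℕ}

/-- **A point of `E₁(ℂ_F)` (in `E(F̄)`, `E = W ⊗ F`) whose parameter lies in `F` is fixed by `Γ_F`** (`z` is injective on `E₁`,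
AEC VII.2.2; `Γ_F` fixes `F`). [cite: SilvermanAEC2009, Prop. VII.2.2] -/
theorem smul_eq_of_zCoord_eq_algebraMap_curveF {P : (curveF F W).geomPoints}
    (hP : geomToC W P ∈ kernel (NormedField.valuation (K := CompletedAlgClosure F)) (curveOver (CompletedAlgClosure F) W))
    {x : F} (hx : (geomToC W P).zCoord = algebraMap F (CompletedAlgClosure F) x) (σ : absoluteGaloisGroup F) : σ • P = P := by
  apply geomToC_injective W
  rw [geomToC_smul]
  have hσP : galPointC W σ (geomToC W P) ∈
      kernel (NormedField.valuation (K := CompletedAlgClosure F)) (curveOver (CompletedAlgClosure F) W) :=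
    galPointHom_mem_kernel (CompletedAlgClosure.galRingHom σ) (galRingHom_cK σ) (norm_galRingHom σ) (@hP)
  refine eq_of_zCoord_eq (@hσP) (@hP) ?_
  have h := zCoord_galPointHom (W := W) (CompletedAlgClosure.galRingHom σ) (galRingHom_cK σ) (geomToC W P)
  change (galPointC W σ (geomToC W P)).zCoord = _ at h
  rw [h, hx, ← CompletedAlgClosure.smul_def, CompletedAlgClosure.smul_algebraMap]

omit [ValuativeRel F] [TopologicalSpace F] [IsNonarchimedeanLocalField F] in
/-- `m • Q` is a `p`-power division sequence when `Q` is. [cite: SilvermanAEC2009, VIII.§2] -/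
theorem nsmul_divSeq_curveF {Q : ℕ → (curveF F W).geomPoints} (hQ : ∀ n, p • Q (n + 1) = Q n) (m n : ℕ) :
    p • (m • Q (n + 1)) = m • Q n := by
  rw [smul_comm, hQ]

omit [ValuativeRel F] [TopologicalSpace F] [IsNonarchimedeanLocalField F] in
/-- `m • Q₀` is `Γ_F`-fixed when `Q₀` is. [cite: SilvermanAEC2009, VIII.§2] -/
theorem smul_nsmul_eq_of_smul_eq_curveF {Q : ℕ → (curveF F W).geomPoints}
    (hfix : ∀ σ : absoluteGaloisGroup F, σ • Q 0 = Q 0) (m : ℕ) (σ : absoluteGaloisGroup F) : σ • (m • Q 0) = m • Q 0 := by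
  have h : σ • (m • Q 0) = m • (σ • Q 0) := map_nsmul (DistribSMul.toAddMonoidHom _ σ) m (Q 0)
  rw [h, hfix]

omit [ValuativeRel F] [TopologicalSpace F] [IsNonarchimedeanLocalField F] in
/-- **The Kummer element of `m • Q` is `m •` the Kummer element of `Q`** (`ℤ`-models). [cite: SilvermanAEC2009, VIII.§2] -/
theorem kummer_nsmul [Fact p.Prime] {Q : ℕ → (curveF F W).geomPoints} (hQ : ∀ n, p • Q (n + 1) = Q n)
    (hfix : ∀ σ : absoluteGaloisGroup F, σ • Q 0 = Q 0) (m : ℕ) (σ : absoluteGaloisGroup F) :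
    TateModule.mk (fun n => σ • (m • Q n) - m • Q n)
        (pow_smul_kummer_eq_zero W (Q := fun n => m • Q n) (nsmul_divSeq_curveF W hQ m) (smul_nsmul_eq_of_smul_eq_curveF W hfix m) σ)
        (smul_kummer_succ W (Q := fun n => m • Q n) (nsmul_divSeq_curveF W hQ m) σ) =
      m • TateModule.mk (fun n => σ • Q n - Q n) (pow_smul_kummer_eq_zero W hQ hfix σ) (smul_kummer_succ W hQ σ) := by
  refine TateModule.ext fun n => ?_
  have h : σ • (m • Q n) = m • (σ • Q n) := map_nsmul (DistribSMul.toAddMonoidHom _ σ) m (Q n)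
  rw [map_nsmul, TateModule.proj_mk, TateModule.proj_mk, h, smul_sub]

/-- `1 ⊗ (m • τ) = m • (1 ⊗ τ)` in `B_dR(F) ⊗ V_pE` (`ℤ`-models). [cite: Kato1993LNM1553, Ch. II §1.2.4] -/
theorem one_tmul_toRational_nsmul_curveF [CharZero F] [Fact p.Prime] [(curveF F W).IsElliptic]
    [Fact (¬ IsUnit (p : integerC F))] [IsAdicComplete (Ideal.span {(p : integerC F)}) (integerC F)]
    (hpF : valuation F p < 1) [Algebra ℚ_[p] F] (m : ℕ) (τ : (curveF F W).tateModule p) :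
    ((1 : (bdRPeriodRingData (F := F) (p := p) hpF).B) ⊗ₜ[ℚ_[p]] TateModule.toRational p (m • τ) :
        (bdRPeriodRingData (F := F) (p := p) hpF).B ⊗[ℚ_[p]] (curveF F W).rationalTateModule p) =
      m • ((1 : (bdRPeriodRingData (F := F) (p := p) hpF).B) ⊗ₜ[ℚ_[p]] TateModule.toRational p τ) := by
  rw [map_nsmul]
  exact map_nsmul ((TensorProduct.mk ℚ_[p] (bdRPeriodRingData (F := F) (p := p) hpF).B ((curveF F W).rationalTateModule p))
    (1 : (bdRPeriodRingData (F := F) (p := p) hpF).B)) m (TateModule.toRational p τ)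

end Rational

section Matching

variable {F : Type} [Field F] [ValuativeRel F] [TopologicalSpace F] [IsNonarchimedeanLocalField F] [CharZero F]
  (W : WeierstrassCurve ℤ) {p : ℕ} [Fact p.Prime] [(curveF F W).IsElliptic] [hE : (curveOver (CompletedAlgClosure F) W).IsElliptic]

/-! ## §3 ★★ with the fixed lift supplied: base parameter in `pℤ_p` -/

/-- ★ **K1 for the algebraic Kummer cocycle of a formal point with parameter in `pℤ_p`** (`W/ℤ`, good supersingular reduction at
`p ≥ 5`, any `p`-adic field `F`): for a `p`-power division sequence `Q` in `E(F̄)` of a point `Q₀ ∈ E₁` with `z(Q₀) = p·c`, `c ∈ ℤ_p`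
(read in `F ⊆ ℂ_F` through the tree's `ℚ_p → F`), `Q₀` is `Γ_F`-fixed and `σ ↦ 1 ⊗ (σQₙ − Qₙ)ₙ` is a `Fil⁰`-coboundary of
`B_dR(F) ⊗ V_pE` (★★ `isFilZeroCoboundary_kummer_curveF_of_five_le` with the constant lift `AinfTop.zpPt c`).
[cite: BlochKato1990, Ex. 3.10.1, Example 3.11] [cite: SilvermanAEC2009, Prop. VII.2.2] -/
theorem isFilZeroCoboundary_kummer_curveF_of_five_le_of_zp
    [Fact (¬ IsUnit (p : integerC F))] [IsAdicComplete (Ideal.span {(p : integerC F)}) (integerC F)]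
    (hpF : valuation F p < 1) [Algebra ℚ_[p] F]
    (hp5 : 5 ≤ p) (hΔ : ¬ (p : ℤ) ∣ W.Δ) (hA : (W.map (Int.castRingHom (ZMod p))).hasseCoeff p = 0)
    {Q : ℕ → (curveF F W).geomPoints} (hQ : ∀ n, p • Q (n + 1) = Q n)
    (hQ0 : geomToC W (Q 0) ∈ kernel (NormedField.valuation (K := CompletedAlgClosure F)) (curveOver (CompletedAlgClosure F) W))
    (c : ℤ_[p]) (hcQ : (geomToC W (Q 0)).zCoord =
      algebraMap F (CompletedAlgClosure F) (LocalField.padicRingHom F p hpF (((p : ℤ_[p]) * c : ℤ_[p]) : ℚ_[p]))) :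
    ∃ hfix : ∀ σ : absoluteGaloisGroup F, σ • Q 0 = Q 0,
      (bdRPeriodRingData (F := F) (p := p) hpF).IsFilZeroCoboundary (rationalTateRep (curveF F W) p) fun σ =>
        ((1 : (bdRPeriodRingData (F := F) (p := p) hpF).B) ⊗ₜ[ℚ_[p]]
          TateModule.toRational p (TateModule.mk (fun n => σ • Q n - Q n) (pow_smul_kummer_eq_zero W hQ hfix σ)
            (smul_kummer_succ W hQ σ)) :
          (bdRPeriodRingData (F := F) (p := p) hpF).B ⊗[ℚ_[p]] (curveF F W).rationalTateModule p) := by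
  have hfix : ∀ σ : absoluteGaloisGroup F, σ • Q 0 = Q 0 := smul_eq_of_zCoord_eq_algebraMap_curveF W hQ0 hcQ
  refine ⟨hfix, ?_⟩
  have hp2 : p ≠ 2 := by omega
  have hker := geomToC_divSeq_mem_kernel W norm_natCast_C_lt_one' hp2 hΔ hA hQ hQ0
  have hQhat : thetaPt W (surjective_fontaineTheta_integerC hpF) (zpPt W (surjective_fontaineTheta_integerC hpF) c) =
      ⟨zPt (geomToC W (Q 0)) (hker 0)⟩ :=
    WeierstrassCurve.Pt.ext (Subtype.ext (Subtype.ext (by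
      rw [coe_val_thetaPt, coe_val_zpPt, coe_theta, coe_fontaineTheta_zpToAinf hpF, coe_zPt, hcQ])))
  exact isFilZeroCoboundary_kummer_curveF_of_five_le W hpF hp5 hΔ hA hQ hfix hQ0 (u₀ := zPt (geomToC W (Q 0)) (hker 0))
    (coe_zPt _) hQhat fun σ => galPtN_zpPt W σ c

/-! ## §4 The index step: `m • Q₀ ∈ Ê(pℤ_p)` suffices -/

/-- ★★ **K1 for the algebraic Kummer cocycle of ANY `Γ_F`-fixed point a non-zero multiple of which lies in `Ê(pℤ_p)`** (the index
step; `W/ℤ`, good supersingular reduction at `p ≥ 5`): `Q` a `p`-power division sequence in `E(F̄)` of a `Γ_F`-fixed `Q₀`, `m ≠ 0` with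
`m • Q₀ ∈ E₁` of parameter `p·c`, `c ∈ ℤ_p`. Then `σ ↦ 1 ⊗ (σQₙ − Qₙ)ₙ` is a `Fil⁰`-coboundary of `B_dR(F) ⊗ V_pE` (★ for `m • Q`, whose
cocycle is `m •` that of `Q`, and `IsFilZeroCoboundary.of_nsmul`). For `F = ℚ_p` every rational point qualifies
(`m = [E(ℚ_p) : Ê(pℤ_p)]`, tree `exists_nsmul_mem_level_of_Δ_ne_zero`): Bloch–Kato Example 3.11 (`⊆`), cocycle level.
[cite: BlochKato1990, Ex. 3.10.1, Example 3.11] [cite: SilvermanAEC2009, Prop. VII.2.1–VII.2.2 and VII.6.3] -/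
theorem isFilZeroCoboundary_kummer_curveF_of_five_le_of_nsmul_of_zp
    [Fact (¬ IsUnit (p : integerC F))] [IsAdicComplete (Ideal.span {(p : integerC F)}) (integerC F)]
    (hpF : valuation F p < 1) [Algebra ℚ_[p] F]
    (hp5 : 5 ≤ p) (hΔ : ¬ (p : ℤ) ∣ W.Δ) (hA : (W.map (Int.castRingHom (ZMod p))).hasseCoeff p = 0)
    {Q : ℕ → (curveF F W).geomPoints} (hQ : ∀ n, p • Q (n + 1) = Q n) (hfix : ∀ σ : absoluteGaloisGroup F, σ • Q 0 = Q 0)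
    {m : ℕ} (hm : m ≠ 0)
    (hQ0 : geomToC W (m • Q 0) ∈ kernel (NormedField.valuation (K := CompletedAlgClosure F)) (curveOver (CompletedAlgClosure F) W))
    (c : ℤ_[p]) (hcQ : (geomToC W (m • Q 0)).zCoord =
      algebraMap F (CompletedAlgClosure F) (LocalField.padicRingHom F p hpF (((p : ℤ_[p]) * c : ℤ_[p]) : ℚ_[p]))) :
    (bdRPeriodRingData (F := F) (p := p) hpF).IsFilZeroCoboundary (rationalTateRep (curveF F W) p) fun σ =>
      ((1 : (bdRPeriodRingData (F := F) (p := p) hpF).B) ⊗ₜ[ℚ_[p]]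
        TateModule.toRational p (TateModule.mk (fun n => σ • Q n - Q n) (pow_smul_kummer_eq_zero W hQ hfix σ)
          (smul_kummer_succ W hQ σ)) :
        (bdRPeriodRingData (F := F) (p := p) hpF).B ⊗[ℚ_[p]] (curveF F W).rationalTateModule p) := by
  obtain ⟨_, h⟩ := isFilZeroCoboundary_kummer_curveF_of_five_le_of_zp W hpF hp5 hΔ hA (Q := fun n => m • Q n)
    (nsmul_divSeq_curveF W hQ m) hQ0 c hcQ
  refine PeriodRingData.IsFilZeroCoboundary.of_nsmul hm (h.congr fun σ => ?_)
  change ((1 : (bdRPeriodRingData (F := F) (p := p) hpF).B) ⊗ₜ[ℚ_[p]] TateModule.toRational p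
    (TateModule.mk (fun n => σ • (m • Q n) - m • Q n)
      (pow_smul_kummer_eq_zero W (Q := fun n => m • Q n) (nsmul_divSeq_curveF W hQ m) (smul_nsmul_eq_of_smul_eq_curveF W hfix m) σ)
      (smul_kummer_succ W (Q := fun n => m • Q n) (nsmul_divSeq_curveF W hQ m) σ)) : _ ⊗[ℚ_[p]] _) = _
  rw [kummer_nsmul W hQ hfix m σ, one_tmul_toRational_nsmul_curveF W hpF]

end Matching

end AinfTop

end Literature.NumberTheory.PAdicHodge

end
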